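import Literature.NumberTheory.Rogawski1990.ArchStableCentralizerEquivCongruence   -- ★ p841403: (N-L)/(N-B) naturality; (T-d) FILES 1–2 tokens
import Literature.NumberTheory.Rogawski1990.IsQuotientOfTransport                -- ★ `IsQuotientOf.transport`, `transportEquiv`, `preClass`
import Literature.NumberTheory.Automorphic.OrbitalMeasureQuotientOfPoint         -- ★ `map_subgroupCongrHomeomorph_conj_eq_map_archStableCentralizerEquiv`
import HarnessLib

/-!
# Coherent Weil data are carried by a congruence of the archimedean unitary groups: the torus datum PUSHED along `Φ`, its coherences
# (C′)∕(C′G), and the Weil form `IsQuotientOf` of the transported family (ROAD-Sd R5 «(T-d) ASSEMBLY», part A-§1)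
(Rogawski (1990), §1.7 p. 6, §4.3 (4.3.1) pp. 43–44, §14.1 p. 232, §14.4 p. 237; Deitmar–Echterhoff (2014), Thm. 1.5.3)

Topic `NumberTheory/Rogawski1990`; namespace `Literature.NumberTheory.Automorphic.UnitaryGroup` (the namespace of ★ `archStableCentralizerEquiv` and of ★
p841403).  THEOREMS ONLY over accepted tree modules (no definition, no instance, no notation, no named fact, no `sorry`).  Cell `hodgecm-mathlib`, crux H413
(`stmt-HodgeConjecture-24833`), ROAD-Sd R5 «`stub_TdAssembly`» (LEAD F0P3a-plan (g9) T8-74 (C); F0P3-p03 (g9); census `F0/P3/F0P3-p03/g9/CENSUS-R5-TdAssembly.F0P3p03g9.md`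
§2 (A1)–(A3) + (A2)); count-neutral floor-1 plumbing; HC_CM is proved only modulo the printed citations until rung 0 closes.

SETTING — the ABSTRACT FRAME of ★ (T-d) FILES 1–5: `Φ : U(H₂)(L ⊗ ℝ) ≃ₜ* U(H)(L ⊗ ℝ)`, `Φ g = T g T⁻¹` (`hΦ`); the Weil data are GIVEN on the SOURCE `U(H₂)` (family `m₂`,
Haar `ν₂`, torus datum `t₂ : ∀ γ, Measure Z(γ)`) and PUSHED to the target: family `m₂.transport Φ …` (★ `OrbitalMeasureFamily.transport`), Haar `ν₂.map Φ`, and the torus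
datum `t` with `t δ = (Φ|_{Z(Φ⁻¹δ)})_* t₂(Φ⁻¹ δ)` — spelled through ★ (T-d) FILE 1's token `subgroupCongrHomeomorph Φ.toMulEquiv Z(Φ⁻¹δ) Z(δ) (forall_archCongr_mem_centralizer_iff L Φ
(Φ.apply_symm_apply δ)) …` (hypothesis `ht`; §1 shows such a `t` exists and reads it at `δ = Φ γ` in ★ p841403's shape).  No definition is introduced.

* §1 `exists_torusPush_archCongr`, `torusPush_archCongr_apply` (the pushed datum at `Φ γ` IS `(Φ|_{Z(γ)})_* t₂ γ` — the dependent-type identity, by `subst`).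
* §2 **(C′) IS CARRIED**: `map_archStableCentralizerEquiv_torusPush_eq` — if `t₂` is coherent under stable conjugacy inside `U(H₂)` (the (C′) conjunct of ★
  `ArchTransfersExistCanonical` ∕ `ArchCentralValueTransfer`, VERBATIM shape), so is `t` inside `U(H)` (★ p841403 (N-B)).  **(C′G) IS CARRIED**:
  `map_archStableCentralizerEquiv_torusPush_eq_of_cross` — coherence of `(t₂, t_X)` across `U(H₂) ↔ U(X)` gives coherence of `(t, t_X)` across `U(H) ↔ U(X)` (★ (N-L)).
* §3 **THE WEIL FORM IS CARRIED**: `isQuotientOf_transport_archCongr` — from (W) `m₂.IsQuotientOf (IsRegularElt ·) ν₂ t₂` and (C′) for `t₂`: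
  `(m₂.transport Φ …).IsQuotientOf (IsRegularElt ·) (ν₂.map Φ) t` (★ `IsQuotientOf.transport`; its representative clause «`t (out c) = (e_c|_Z)_* t₂ (out (Φ⁻¹ c))`» holds
  because `e_c = conj(x_c) ∘ Φ` and `Φ ∘ SCE(out (Φ⁻¹ c), Φ⁻¹ (out c))` are two conjugations taking the REGULAR `out (Φ⁻¹ c)` to `out c`, hence agree on its centraliser —
  ★ `conj_eq_conj_of_conj_eq`, the commutant of a regular element being commutative).  HONEST: coherent data only — an incoherent Weil datum does not push to
  a pointwise datum; the 13-conjunct systems of the letters always carry (C′).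

## References
* [Rogawski1990] J. D. Rogawski, *Automorphic Representations of Unitary Groups in Three Variables*, Ann. of Math. Stud. 123 (1990), §1.7 p. 6, §4.3 pp. 43–44,
  §14.1 p. 232, §14.4 p. 237.
* [DeitmarEchterhoff2014] A. Deitmar, S. Echterhoff, *Principles of Harmonic Analysis*, 2nd ed. (2014), Thm. 1.5.3.
* [PlatonovRapinchuk1994] V. Platonov, A. Rapinchuk, *Algebraic Groups and Number Theory* (1994), §2.3.
-/

set_option autoImplicit false

noncomputable section

open MeasureTheory Measure NumberField NumberField.InfinitePlace
open Literature.MeasureTheory.Group Literature.NumberTheory.Rogawski1990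
open scoped Matrix MatrixGroups

namespace Literature.NumberTheory.Automorphic

namespace UnitaryGroup

section WeilData

variable (L : Type) [Field L] [NumberField L] [IsCMField L] {N : ℕ} {H H₂ X : Matrix (Fin N) (Fin N) L}
  (hH : H.det ≠ 0) (hH₂ : H₂.det ≠ 0) (hX : X.det ≠ 0) (T : GL (Fin N) (mixedEmbedding.mixedSpace L))
  (Φ : arch (↥(maximalRealSubfield L)) L (IsCMField.complexConj L) N H₂ ≃ₜ* arch (↥(maximalRealSubfield L)) L (IsCMField.complexConj L) N H)
  (hΦ : ∀ g : arch (↥(maximalRealSubfield L)) L (IsCMField.complexConj L) N H₂,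
    ((Φ g : arch (↥(maximalRealSubfield L)) L (IsCMField.complexConj L) N H) : GL (Fin N) (mixedEmbedding.mixedSpace L)) =
      T * (g : GL (Fin N) (mixedEmbedding.mixedSpace L)) * T⁻¹)
  [MeasurableSpace (arch (↥(maximalRealSubfield L)) L (IsCMField.complexConj L) N H₂)] [BorelSpace (arch (↥(maximalRealSubfield L)) L (IsCMField.complexConj L) N H₂)]
  [MeasurableSpace (arch (↥(maximalRealSubfield L)) L (IsCMField.complexConj L) N H)] [BorelSpace (arch (↥(maximalRealSubfield L)) L (IsCMField.complexConj L) N H)]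
  [MeasurableSpace (arch (↥(maximalRealSubfield L)) L (IsCMField.complexConj L) N X)] [BorelSpace (arch (↥(maximalRealSubfield L)) L (IsCMField.complexConj L) N X)]
  (t₂ : ∀ γ : arch (↥(maximalRealSubfield L)) L (IsCMField.complexConj L) N H₂, Measure (Subgroup.centralizer ({γ} : Set _)))
  (t : ∀ δ : arch (↥(maximalRealSubfield L)) L (IsCMField.complexConj L) N H, Measure (Subgroup.centralizer ({δ} : Set _)))
  (ht : ∀ δ, t δ = Measure.map (subgroupCongrHomeomorph Φ.toMulEquiv (Subgroup.centralizer ({Φ.symm δ} : Set _)) (Subgroup.centralizer ({δ} : Set _))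
    (forall_archCongr_mem_centralizer_iff L Φ (Φ.apply_symm_apply δ)) Φ.continuous Φ.symm.continuous) (t₂ (Φ.symm δ)))

/-! ## §1 The torus datum pushed along `Φ` -/

omit hH hH₂ hX T hΦ [BorelSpace (arch (↥(maximalRealSubfield L)) L (IsCMField.complexConj L) N H₂)]
  [BorelSpace (arch (↥(maximalRealSubfield L)) L (IsCMField.complexConj L) N H)] in
/-- **The pushed torus datum exists** (it is the lambda `δ ↦ (Φ|_{Z(Φ⁻¹δ)})_* t₂(Φ⁻¹δ)`; no definition is introduced). [cite: Rogawski1990, §1.7 p. 6] -/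
theorem exists_torusPush_archCongr :
    ∃ t : ∀ δ : arch (↥(maximalRealSubfield L)) L (IsCMField.complexConj L) N H, Measure (Subgroup.centralizer ({δ} : Set _)),
      ∀ δ, t δ = Measure.map (subgroupCongrHomeomorph Φ.toMulEquiv (Subgroup.centralizer ({Φ.symm δ} : Set _)) (Subgroup.centralizer ({δ} : Set _))
        (forall_archCongr_mem_centralizer_iff L Φ (Φ.apply_symm_apply δ)) Φ.continuous Φ.symm.continuous) (t₂ (Φ.symm δ)) :=
  ⟨_, fun _ => rfl⟩

omit hH hH₂ hX T hΦ [BorelSpace (arch (↥(maximalRealSubfield L)) L (IsCMField.complexConj L) N H₂)]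
  [BorelSpace (arch (↥(maximalRealSubfield L)) L (IsCMField.complexConj L) N H)] in
include ht in
/-- **The pushed datum at `Φ γ` is `(Φ|_{Z(γ)})_* t₂ γ`** — ★ p841403's shape «`t (Φ γ) = (Φ|_Z)_* t₂ γ`» (the dependent-type bookkeeping `Z(Φ⁻¹(Φ γ)) = Z(γ)`).
[cite: Rogawski1990, §1.7 p. 6] -/
theorem torusPush_archCongr_apply (γ : arch (↥(maximalRealSubfield L)) L (IsCMField.complexConj L) N H₂) :
    t (Φ γ) = Measure.map (subgroupCongrHomeomorph Φ.toMulEquiv (Subgroup.centralizer ({γ} : Set _)) (Subgroup.centralizer ({Φ γ} : Set _))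
      (forall_archCongr_mem_centralizer_iff L Φ rfl) Φ.continuous Φ.symm.continuous) (t₂ γ) := by
  rw [ht]
  -- generalise the conjugate copy `γ' = Φ⁻¹ (Φ γ)` of `γ` to a variable and substitute
  have key : ∀ (γ' : arch (↥(maximalRealSubfield L)) L (IsCMField.complexConj L) N H₂) (e : γ' = γ) (p : Φ γ' = Φ γ),
      Measure.map (subgroupCongrHomeomorph Φ.toMulEquiv (Subgroup.centralizer ({γ'} : Set _)) (Subgroup.centralizer ({Φ γ} : Set _))
        (forall_archCongr_mem_centralizer_iff L Φ p) Φ.continuous Φ.symm.continuous) (t₂ γ') =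
      Measure.map (subgroupCongrHomeomorph Φ.toMulEquiv (Subgroup.centralizer ({γ} : Set _)) (Subgroup.centralizer ({Φ γ} : Set _))
        (forall_archCongr_mem_centralizer_iff L Φ rfl) Φ.continuous Φ.symm.continuous) (t₂ γ) := by
    intro γ' e p
    subst e
    rfl
  exact key _ (Φ.symm_apply_apply γ) (Φ.apply_symm_apply (Φ γ))

/-! ## §2 Coherence is carried: (C′) and (C′G) -/

include hΦ ht in
/-- **(C′) IS CARRIED BY `Φ`.**  If `t₂` is coherent under stable conjugacy inside `U(H₂)(L ⊗ ℝ)` — the (C′) conjunct of the letters, VERBATIM shape — then the pushed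
datum `t` is coherent inside `U(H)(L ⊗ ℝ)` (★ p841403 (N-B) + §1). [cite: Rogawski1990, §4.3 pp. 43–44; §14.1 p. 232] [cite: DeitmarEchterhoff2014, Thm. 1.5.3] -/
theorem map_archStableCentralizerEquiv_torusPush_eq
    (hC₂ : ∀ (γ₁ γ₂ : arch (↥(maximalRealSubfield L)) L (IsCMField.complexConj L) N H₂)
      (h₁ : IsRegularElt (γ₁.val : GL (Fin N) (mixedEmbedding.mixedSpace L)))
      (hc : Corresponds (conjMixed (↥(maximalRealSubfield L)) L (IsCMField.complexConj L)) (archFormOf L N H₂) (archFormOf L N H₂) γ₁ γ₂),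
      Measure.map (archStableCentralizerEquiv L hH₂ hH₂ hc h₁) (t₂ γ₁) = t₂ γ₂)
    (δ₁ δ₂ : arch (↥(maximalRealSubfield L)) L (IsCMField.complexConj L) N H)
    (h₁ : IsRegularElt (δ₁.val : GL (Fin N) (mixedEmbedding.mixedSpace L)))
    (hc : Corresponds (conjMixed (↥(maximalRealSubfield L)) L (IsCMField.complexConj L)) (archFormOf L N H) (archFormOf L N H) δ₁ δ₂) :
    Measure.map (archStableCentralizerEquiv L hH hH hc h₁) (t δ₁) = t δ₂ := by
  obtain ⟨γ₁, rfl⟩ := Φ.surjective δ₁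
  obtain ⟨γ₂, rfl⟩ := Φ.surjective δ₂
  rw [torusPush_archCongr_apply L Φ t₂ t ht γ₁, torusPush_archCongr_apply L Φ t₂ t ht γ₂,
    map_archStableCentralizerEquiv_map_subgroupCongrHomeomorph_archCongr_both L hH hH₂ T Φ hΦ hc h₁ (t₂ γ₁)]
  congr 1
  exact hC₂ γ₁ γ₂ _ _

include hΦ ht in
/-- **(C′G) IS CARRIED BY `Φ`.**  If `(t₂, t_X)` is coherent across `U(H₂)(L ⊗ ℝ) ↔ U(X)(L ⊗ ℝ)` — the (C′G) conjunct of the letters with `X = Φ₃`, VERBATIM shape — then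
`(t, t_X)` is coherent across `U(H) ↔ U(X)` (★ p841403 (N-L) + §1). [cite: Rogawski1990, §4.3 pp. 43–44; §14.1 p. 232] [cite: DeitmarEchterhoff2014, Thm. 1.5.3] -/
theorem map_archStableCentralizerEquiv_torusPush_eq_of_cross
    (tX : ∀ a : arch (↥(maximalRealSubfield L)) L (IsCMField.complexConj L) N X, Measure (Subgroup.centralizer ({a} : Set _)))
    (hCG₂ : ∀ (γ : arch (↥(maximalRealSubfield L)) L (IsCMField.complexConj L) N H₂) (a : arch (↥(maximalRealSubfield L)) L (IsCMField.complexConj L) N X)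
      (h' : IsRegularElt (γ.val : GL (Fin N) (mixedEmbedding.mixedSpace L)))
      (hc : Corresponds (conjMixed (↥(maximalRealSubfield L)) L (IsCMField.complexConj L)) (archFormOf L N H₂) (archFormOf L N X) γ a),
      Measure.map (archStableCentralizerEquiv L hH₂ hX hc h') (t₂ γ) = tX a)
    (δ : arch (↥(maximalRealSubfield L)) L (IsCMField.complexConj L) N H) (a : arch (↥(maximalRealSubfield L)) L (IsCMField.complexConj L) N X)
    (h' : IsRegularElt (δ.val : GL (Fin N) (mixedEmbedding.mixedSpace L)))
    (hc : Corresponds (conjMixed (↥(maximalRealSubfield L)) L (IsCMField.complexConj L)) (archFormOf L N H) (archFormOf L N X) δ a) :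
    Measure.map (archStableCentralizerEquiv L hH hX hc h') (t δ) = tX a := by
  obtain ⟨γ, rfl⟩ := Φ.surjective δ
  rw [torusPush_archCongr_apply L Φ t₂ t ht γ,
    map_archStableCentralizerEquiv_map_subgroupCongrHomeomorph_archCongr_left L hH hH₂ hX T Φ hΦ hc h' (t₂ γ)]
  exact hCG₂ γ a _ _


/-! ## §3 The Weil form is carried -/

variable
  [∀ γ : arch (↥(maximalRealSubfield L)) L (IsCMField.complexConj L) N H₂,
    MeasurableSpace (arch (↥(maximalRealSubfield L)) L (IsCMField.complexConj L) N H₂ ⧸ Subgroup.centralizer ({γ} : Set _))]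
  [∀ γ : arch (↥(maximalRealSubfield L)) L (IsCMField.complexConj L) N H₂,
    BorelSpace (arch (↥(maximalRealSubfield L)) L (IsCMField.complexConj L) N H₂ ⧸ Subgroup.centralizer ({γ} : Set _))]
  [∀ δ : arch (↥(maximalRealSubfield L)) L (IsCMField.complexConj L) N H,
    MeasurableSpace (arch (↥(maximalRealSubfield L)) L (IsCMField.complexConj L) N H ⧸ Subgroup.centralizer ({δ} : Set _))]
  [∀ δ : arch (↥(maximalRealSubfield L)) L (IsCMField.complexConj L) N H,
    BorelSpace (arch (↥(maximalRealSubfield L)) L (IsCMField.complexConj L) N H ⧸ Subgroup.centralizer ({δ} : Set _))]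

omit [MeasurableSpace (arch (↥(maximalRealSubfield L)) L (IsCMField.complexConj L) N H₂)] [BorelSpace (arch (↥(maximalRealSubfield L)) L (IsCMField.complexConj L) N H₂)]
  [MeasurableSpace (arch (↥(maximalRealSubfield L)) L (IsCMField.complexConj L) N H)] [BorelSpace (arch (↥(maximalRealSubfield L)) L (IsCMField.complexConj L) N H)]
  [∀ γ : arch (↥(maximalRealSubfield L)) L (IsCMField.complexConj L) N H₂,
    BorelSpace (arch (↥(maximalRealSubfield L)) L (IsCMField.complexConj L) N H₂ ⧸ Subgroup.centralizer ({γ} : Set _))]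
  [∀ δ : arch (↥(maximalRealSubfield L)) L (IsCMField.complexConj L) N H,
    BorelSpace (arch (↥(maximalRealSubfield L)) L (IsCMField.complexConj L) N H ⧸ Subgroup.centralizer ({δ} : Set _))]
  [∀ γ : arch (↥(maximalRealSubfield L)) L (IsCMField.complexConj L) N H₂,
    MeasurableSpace (arch (↥(maximalRealSubfield L)) L (IsCMField.complexConj L) N H₂ ⧸ Subgroup.centralizer ({γ} : Set _))]
  [∀ δ : arch (↥(maximalRealSubfield L)) L (IsCMField.complexConj L) N H,
    MeasurableSpace (arch (↥(maximalRealSubfield L)) L (IsCMField.complexConj L) N H ⧸ Subgroup.centralizer ({δ} : Set _))] in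
include hΦ in
/-- **The two transports to `Z(out c)` agree on a regular class.**  For a class `c` of `U(H)(L ⊗ ℝ)` with regular representative, `b₀ := out (Φ⁻¹ c)` and `b₁ := Φ⁻¹ (out c)`
(two conjugate — hence stably conjugate — regular elements of `U(H₂)(L ⊗ ℝ)`): `e_c|_{Z(b₀)} = Φ|_{Z(b₁)} ∘ SCE(b₀, b₁)` as maps into `Z(out c)`, where
`e_c = conj(x_c) ∘ Φ` is ★ `transportEquiv` — both are conjugations taking `b₀` to `out c`, and the commutant of the regular `b₀` is commutative
(★ `conj_eq_conj_of_conj_eq`). [cite: Rogawski1990, §4.3 pp. 43–44] [cite: PlatonovRapinchuk1994, §2.3] -/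
theorem subgroupCongrHomeomorph_transportEquiv_eq_comp
    (c : ConjClasses (arch (↥(maximalRealSubfield L)) L (IsCMField.complexConj L) N H))
    (h₀ : IsRegularElt ((Quotient.out (preClass Φ.toMulEquiv c) : arch (↥(maximalRealSubfield L)) L (IsCMField.complexConj L) N H₂).val :
      GL (Fin N) (mixedEmbedding.mixedSpace L)))
    (hc : Corresponds (conjMixed (↥(maximalRealSubfield L)) L (IsCMField.complexConj L)) (archFormOf L N H₂) (archFormOf L N H₂)
      (Quotient.out (preClass Φ.toMulEquiv c)) (Φ.symm (Quotient.out c))) :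
    (subgroupCongrHomeomorph (transportEquiv Φ.toMulEquiv c)
        (Subgroup.centralizer ({(Quotient.out (preClass Φ.toMulEquiv c) : arch (↥(maximalRealSubfield L)) L (IsCMField.complexConj L) N H₂)} : Set _))
        (Subgroup.centralizer ({(Quotient.out c : arch (↥(maximalRealSubfield L)) L (IsCMField.complexConj L) N H)} : Set _))
        (forall_apply_mem_centralizer_singleton_iff_of_eq (transportEquiv Φ.toMulEquiv c) (transportEquiv_out Φ.toMulEquiv c))
        (continuous_transportEquiv Φ.toMulEquiv Φ.continuous c) (continuous_transportEquiv_symm Φ.toMulEquiv Φ.symm.continuous c) :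
      _ → Subgroup.centralizer ({(Quotient.out c : arch (↥(maximalRealSubfield L)) L (IsCMField.complexConj L) N H)} : Set _)) =
    (subgroupCongrHomeomorph Φ.toMulEquiv (Subgroup.centralizer ({Φ.symm (Quotient.out c)} : Set _)) (Subgroup.centralizer ({Quotient.out c} : Set _))
        (forall_archCongr_mem_centralizer_iff L Φ (Φ.apply_symm_apply (Quotient.out c))) Φ.continuous Φ.symm.continuous) ∘
      (archStableCentralizerEquiv L hH₂ hH₂ hc h₀) := by
  -- notation-free abbreviations by `have`: GL values of the players
  -- a conjugator `y` of `b₀ := out (Φ⁻¹ c)` to `b₁ := Φ⁻¹ (out c)` inside `GL_N(L ⊗ ℝ)`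
  obtain ⟨y, hy⟩ := isConj_iff.1 hc
  have hy' : y * ((Quotient.out (preClass Φ.toMulEquiv c) : arch (↥(maximalRealSubfield L)) L (IsCMField.complexConj L) N H₂).val :
      GL (Fin N) (mixedEmbedding.mixedSpace L)) * y⁻¹ = (Φ.symm (Quotient.out c)).val := hy
  -- `Φ` on GL values
  have hΦ₀ : ((Φ.toMulEquiv (Quotient.out (preClass Φ.toMulEquiv c)) : arch (↥(maximalRealSubfield L)) L (IsCMField.complexConj L) N H).val :
      GL (Fin N) (mixedEmbedding.mixedSpace L)) =
      T * (Quotient.out (preClass Φ.toMulEquiv c) : arch (↥(maximalRealSubfield L)) L (IsCMField.complexConj L) N H₂).val * T⁻¹ := hΦ _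
  have hΦ₁ : ((Quotient.out c : arch (↥(maximalRealSubfield L)) L (IsCMField.complexConj L) N H).val : GL (Fin N) (mixedEmbedding.mixedSpace L)) =
      T * (Φ.symm (Quotient.out c)).val * T⁻¹ := by
    have h2 : ((Φ (Φ.symm (Quotient.out c)) : arch (↥(maximalRealSubfield L)) L (IsCMField.complexConj L) N H).val : GL (Fin N) (mixedEmbedding.mixedSpace L)) =
        T * (Φ.symm (Quotient.out c)).val * T⁻¹ := hΦ _
    rwa [ContinuousMulEquiv.apply_symm_apply] at h2
  -- the two conjugators of `b₀` to `out c`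
  have hx := congrArg (fun g : arch (↥(maximalRealSubfield L)) L (IsCMField.complexConj L) N H => (g.val : GL (Fin N) (mixedEmbedding.mixedSpace L)))
    (transportConj_spec Φ.toMulEquiv c)
  simp only [Subgroup.coe_mul, Subgroup.coe_inv] at hx
  have hu₁ : ((transportConj Φ.toMulEquiv c : arch (↥(maximalRealSubfield L)) L (IsCMField.complexConj L) N H).val * T) *
      ((Quotient.out (preClass Φ.toMulEquiv c) : arch (↥(maximalRealSubfield L)) L (IsCMField.complexConj L) N H₂).val : GL (Fin N) (mixedEmbedding.mixedSpace L)) *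
      ((transportConj Φ.toMulEquiv c : arch (↥(maximalRealSubfield L)) L (IsCMField.complexConj L) N H).val * T)⁻¹ =
      (Quotient.out c : arch (↥(maximalRealSubfield L)) L (IsCMField.complexConj L) N H).val := by
    rw [← hx, hΦ₀]; group
  have hu₂ : (T * y) *
      ((Quotient.out (preClass Φ.toMulEquiv c) : arch (↥(maximalRealSubfield L)) L (IsCMField.complexConj L) N H₂).val : GL (Fin N) (mixedEmbedding.mixedSpace L)) * (T * y)⁻¹ =
      (Quotient.out c : arch (↥(maximalRealSubfield L)) L (IsCMField.complexConj L) N H).val := by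
    rw [hΦ₁, ← hy']; group
  funext z
  apply Subtype.ext
  apply Subtype.ext
  have hz : ((z : arch (↥(maximalRealSubfield L)) L (IsCMField.complexConj L) N H₂).val : GL (Fin N) (mixedEmbedding.mixedSpace L)) *
      (Quotient.out (preClass Φ.toMulEquiv c) : arch (↥(maximalRealSubfield L)) L (IsCMField.complexConj L) N H₂).val =
      (Quotient.out (preClass Φ.toMulEquiv c) : arch (↥(maximalRealSubfield L)) L (IsCMField.complexConj L) N H₂).val *
        (z : arch (↥(maximalRealSubfield L)) L (IsCMField.complexConj L) N H₂).val :=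
    congrArg Subtype.val (Subgroup.mem_centralizer_singleton_iff.mp z.2)
  have hΦz : ((Φ.toMulEquiv (z : arch (↥(maximalRealSubfield L)) L (IsCMField.complexConj L) N H₂) : arch (↥(maximalRealSubfield L)) L (IsCMField.complexConj L) N H).val :
      GL (Fin N) (mixedEmbedding.mixedSpace L)) = T * (z : arch (↥(maximalRealSubfield L)) L (IsCMField.complexConj L) N H₂).val * T⁻¹ := hΦ _
  -- left: `e_c z = x_c (Φ z) x_c⁻¹`
  have hL : (((subgroupCongrHomeomorph (transportEquiv Φ.toMulEquiv c)
        (Subgroup.centralizer ({(Quotient.out (preClass Φ.toMulEquiv c) : arch (↥(maximalRealSubfield L)) L (IsCMField.complexConj L) N H₂)} : Set _))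
        (Subgroup.centralizer ({(Quotient.out c : arch (↥(maximalRealSubfield L)) L (IsCMField.complexConj L) N H)} : Set _))
        (forall_apply_mem_centralizer_singleton_iff_of_eq (transportEquiv Φ.toMulEquiv c) (transportEquiv_out Φ.toMulEquiv c))
        (continuous_transportEquiv Φ.toMulEquiv Φ.continuous c) (continuous_transportEquiv_symm Φ.toMulEquiv Φ.symm.continuous c) z :
        Subgroup.centralizer _) : arch (↥(maximalRealSubfield L)) L (IsCMField.complexConj L) N H).val : GL (Fin N) (mixedEmbedding.mixedSpace L)) =
      (transportConj Φ.toMulEquiv c : arch (↥(maximalRealSubfield L)) L (IsCMField.complexConj L) N H).val *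
        (T * (z : arch (↥(maximalRealSubfield L)) L (IsCMField.complexConj L) N H₂).val * T⁻¹) *
        ((transportConj Φ.toMulEquiv c : arch (↥(maximalRealSubfield L)) L (IsCMField.complexConj L) N H).val)⁻¹ := by
    rw [coe_subgroupCongrHomeomorph_apply, transportEquiv_apply]
    simp only [Subgroup.coe_mul, Subgroup.coe_inv, hΦz]
  -- right: `Φ (SCE z) = T (y z y⁻¹) T⁻¹`
  have hR : (((subgroupCongrHomeomorph Φ.toMulEquiv (Subgroup.centralizer ({Φ.symm (Quotient.out c)} : Set _)) (Subgroup.centralizer ({Quotient.out c} : Set _))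
        (forall_archCongr_mem_centralizer_iff L Φ (Φ.apply_symm_apply (Quotient.out c))) Φ.continuous Φ.symm.continuous
      (archStableCentralizerEquiv L hH₂ hH₂ hc h₀ z) : Subgroup.centralizer _) : arch (↥(maximalRealSubfield L)) L (IsCMField.complexConj L) N H).val :
        GL (Fin N) (mixedEmbedding.mixedSpace L)) =
      T * (y * ((z : arch (↥(maximalRealSubfield L)) L (IsCMField.complexConj L) N H₂).val : GL (Fin N) (mixedEmbedding.mixedSpace L)) * y⁻¹) * T⁻¹ := by
    have hΦs : ((Φ.toMulEquiv ((archStableCentralizerEquiv L hH₂ hH₂ hc h₀ z : Subgroup.centralizer _) : arch (↥(maximalRealSubfield L)) L (IsCMField.complexConj L) N H₂) :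
        arch (↥(maximalRealSubfield L)) L (IsCMField.complexConj L) N H).val : GL (Fin N) (mixedEmbedding.mixedSpace L)) =
        T * ((archStableCentralizerEquiv L hH₂ hH₂ hc h₀ z : Subgroup.centralizer _) : arch (↥(maximalRealSubfield L)) L (IsCMField.complexConj L) N H₂).val * T⁻¹ :=
      hΦ _
    rw [coe_subgroupCongrHomeomorph_apply, hΦs, coe_archStableCentralizerEquiv_eq_of_conj_eq L hH₂ hH₂ hc h₀ y hy' z]
  rw [Function.comp_apply, hL, hR]
  -- both are conjugations of `z` by a conjugator of `b₀` to `out c`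
  have key := conj_eq_conj_of_conj_eq (commute_of_commute_of_isRegularElt_arch L _ h₀) hu₁ hu₂ hz
  calc (transportConj Φ.toMulEquiv c : arch (↥(maximalRealSubfield L)) L (IsCMField.complexConj L) N H).val *
        (T * ((z : arch (↥(maximalRealSubfield L)) L (IsCMField.complexConj L) N H₂).val : GL (Fin N) (mixedEmbedding.mixedSpace L)) * T⁻¹) *
        ((transportConj Φ.toMulEquiv c : arch (↥(maximalRealSubfield L)) L (IsCMField.complexConj L) N H).val)⁻¹
      = ((transportConj Φ.toMulEquiv c : arch (↥(maximalRealSubfield L)) L (IsCMField.complexConj L) N H).val * T) *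
          ((z : arch (↥(maximalRealSubfield L)) L (IsCMField.complexConj L) N H₂).val : GL (Fin N) (mixedEmbedding.mixedSpace L)) *
          ((transportConj Φ.toMulEquiv c : arch (↥(maximalRealSubfield L)) L (IsCMField.complexConj L) N H).val * T)⁻¹ := by group
    _ = (T * y) * ((z : arch (↥(maximalRealSubfield L)) L (IsCMField.complexConj L) N H₂).val : GL (Fin N) (mixedEmbedding.mixedSpace L)) * (T * y)⁻¹ := key
    _ = T * (y * ((z : arch (↥(maximalRealSubfield L)) L (IsCMField.complexConj L) N H₂).val : GL (Fin N) (mixedEmbedding.mixedSpace L)) * y⁻¹) * T⁻¹ := by group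

include hΦ ht in
/-- **THE WEIL FORM IS CARRIED BY `Φ`.**  From (W) `m₂.IsQuotientOf (IsRegularElt ·) ν₂ t₂` on `U(H₂)(L ⊗ ℝ)` and (C′) for `t₂`, with `ν = Φ_* ν₂`: the transported family
`Φ_* m₂` (★ `OrbitalMeasureFamily.transport`) IS the Weil quotient of `ν` by the PUSHED datum `t` on the regular classes of `U(H)(L ⊗ ℝ)`:
`(Φ_* m₂).IsQuotientOf (IsRegularElt ·) ν t` (★ `IsQuotientOf.transport`; its representative clause by §3's agreement + (C′) between the two conjugate lifts
`out (Φ⁻¹ c)`, `Φ⁻¹ (out c)`). [cite: Rogawski1990, §1.7 p. 6; §4.3 (4.3.1) p. 43] [cite: DeitmarEchterhoff2014, Thm. 1.5.3] -/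
theorem isQuotientOf_transport_archCongr
    {ν₂ : Measure (arch (↥(maximalRealSubfield L)) L (IsCMField.complexConj L) N H₂)} [ν₂.IsHaarMeasure] [ν₂.IsMulRightInvariant]
    {m₂ : OrbitalMeasureFamily (arch (↥(maximalRealSubfield L)) L (IsCMField.complexConj L) N H₂)}
    (hW : m₂.IsQuotientOf (fun γ => IsRegularElt (γ.val : GL (Fin N) (mixedEmbedding.mixedSpace L))) ν₂ t₂)
    (hC₂ : ∀ (γ₁ γ₂ : arch (↥(maximalRealSubfield L)) L (IsCMField.complexConj L) N H₂)
      (h₁ : IsRegularElt (γ₁.val : GL (Fin N) (mixedEmbedding.mixedSpace L)))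
      (hc : Corresponds (conjMixed (↥(maximalRealSubfield L)) L (IsCMField.complexConj L)) (archFormOf L N H₂) (archFormOf L N H₂) γ₁ γ₂),
      Measure.map (archStableCentralizerEquiv L hH₂ hH₂ hc h₁) (t₂ γ₁) = t₂ γ₂)
    (ν : Measure (arch (↥(maximalRealSubfield L)) L (IsCMField.complexConj L) N H)) [ν.IsHaarMeasure] [ν.IsMulRightInvariant]
    (hν : ν = ν₂.map Φ) :
    (m₂.transport Φ.toMulEquiv Φ.continuous Φ.symm.continuous).IsQuotientOf
      (fun δ => IsRegularElt (δ.val : GL (Fin N) (mixedEmbedding.mixedSpace L))) ν t := by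
  -- regularity passes between `out c`, `Φ⁻¹ (out c)` and the conjugate lift `out (Φ⁻¹ c)`
  have hreg : ∀ c : ConjClasses (arch (↥(maximalRealSubfield L)) L (IsCMField.complexConj L) N H),
      IsRegularElt ((Quotient.out c : arch (↥(maximalRealSubfield L)) L (IsCMField.complexConj L) N H).val : GL (Fin N) (mixedEmbedding.mixedSpace L)) →
      IsRegularElt ((Φ.symm (Quotient.out c)).val : GL (Fin N) (mixedEmbedding.mixedSpace L)) ∧
      Corresponds (conjMixed (↥(maximalRealSubfield L)) L (IsCMField.complexConj L)) (archFormOf L N H₂) (archFormOf L N H₂)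
        (Quotient.out (preClass Φ.toMulEquiv c)) (Φ.symm (Quotient.out c)) ∧
      IsRegularElt ((Quotient.out (preClass Φ.toMulEquiv c) : arch (↥(maximalRealSubfield L)) L (IsCMField.complexConj L) N H₂).val :
        GL (Fin N) (mixedEmbedding.mixedSpace L)) := by
    intro c hc
    have h1 : IsRegularElt ((Φ.symm (Quotient.out c)).val : GL (Fin N) (mixedEmbedding.mixedSpace L)) := by
      rw [← isRegularElt_coe_archCongr_iff L T Φ hΦ, ContinuousMulEquiv.apply_symm_apply]
      exact hc
    have h2 : Corresponds (conjMixed (↥(maximalRealSubfield L)) L (IsCMField.complexConj L)) (archFormOf L N H₂) (archFormOf L N H₂)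
        (Quotient.out (preClass Φ.toMulEquiv c)) (Φ.symm (Quotient.out c)) :=
      (arch (↥(maximalRealSubfield L)) L (IsCMField.complexConj L) N H₂).subtype.map_isConj (isConj_out_preClass Φ.toMulEquiv c)
    exact ⟨h1, h2, isRegularElt_of_isConj h2.symm h1⟩
  refine hW.transport Φ.toMulEquiv Φ.continuous Φ.symm.continuous ν₂ t₂ ν (by rw [hν]; rfl) (fun c hc => (hreg c hc).2.2) t (fun c hc => ?_)
  obtain ⟨h1, h2, h0⟩ := hreg c hc
  rw [ht (Quotient.out c), ← hC₂ _ _ h0 h2]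
  have hcomp := subgroupCongrHomeomorph_transportEquiv_eq_comp L hH₂ T Φ hΦ c h0 h2
  calc Measure.map (subgroupCongrHomeomorph Φ.toMulEquiv (Subgroup.centralizer ({Φ.symm (Quotient.out c)} : Set _)) (Subgroup.centralizer ({Quotient.out c} : Set _))
          (forall_archCongr_mem_centralizer_iff L Φ (Φ.apply_symm_apply (Quotient.out c))) Φ.continuous Φ.symm.continuous)
        (Measure.map (archStableCentralizerEquiv L hH₂ hH₂ h2 h0) (t₂ (Quotient.out (preClass Φ.toMulEquiv c))))
      = Measure.map ((subgroupCongrHomeomorph Φ.toMulEquiv (Subgroup.centralizer ({Φ.symm (Quotient.out c)} : Set _)) (Subgroup.centralizer ({Quotient.out c} : Set _))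
          (forall_archCongr_mem_centralizer_iff L Φ (Φ.apply_symm_apply (Quotient.out c))) Φ.continuous Φ.symm.continuous) ∘
          (archStableCentralizerEquiv L hH₂ hH₂ h2 h0)) (t₂ (Quotient.out (preClass Φ.toMulEquiv c))) :=
        Measure.map_map (Homeomorph.continuous _).measurable (map_continuous (archStableCentralizerEquiv L hH₂ hH₂ h2 h0)).measurable
    _ = _ := (congrArg (fun f => Measure.map f (t₂ (Quotient.out (preClass Φ.toMulEquiv c)))) hcomp).symm

end WeilData

end UnitaryGroup

end Literature.NumberTheory.Automorphic

end
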